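import Mathlib
import Summits.ValiantsHypothesis.ValiantsHypothesis.Theorems.NewtonUnitEquationsNewtonTauWeakCornerDefs

/-!
# `NewtonTauWeak` (stmt-ValiantsHypothesis-5904), line `binomial-normal-form`: corner model — words and the
# weight bound

Support file for the crux
`Summit.ValiantsHypothesis.ValiantsHypothesis.Theses.NewtonUnitEquations.NewtonTauWeak`
(KPTT arXiv:1308.2286 Conj. 1, weak form), open stub `stub_binomialNewtonTauCommon`; first of three files
formalising the `K = 3` CORNER RIGIDITY LEMMA of `Cruxes/NewtonTauWeak/Lines/binomial-normal-form-ltc.md` §5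
(lead c2) over the objects of `…CornerDefs.lean`.  This file: routine API of the push-forward, separated
coefficients, words with at most one letter, orders of univariate factors, the word box; and the WEIGHT BOUND
`weight_ge_two_lightest` (registered stub): if `e₁` minimises `o_e⟨w,E_e⟩` over the active directions of a
separated product and `e₂` minimises it over the others, every word with two nonzero letters and nonzero
separated coefficient weighs at least `o_{e₁}⟨w,E_{e₁}⟩ + o_{e₂}⟨w,E_{e₂}⟩`, with equality only for the
two-letter word `o_{e₁}[e₁] + o_{e₂}[e₂]` (genericity of `w` turns equal weights of ray points into equal
lattice points, and non-parallel rays into equal directions).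

Main results: `weight_ge_two_lightest`; API `push_single`, `sepCoeff_single`, `sepCoeff_pair`,
`eq_zero_or_single_of_card_le_one`, `two_le_card_of_offRay`, `exists_isOrder`.  No definitions. [folklore]
-/

-- the namespace mandated for this Theorems file repeats the component `ValiantsHypothesis`
set_option linter.dupNamespace false

noncomputable section

open scoped BigOperators Polynomial

namespace Summit.ValiantsHypothesis.ValiantsHypothesis.Theorems.NewtonTauWeakCorner


/-! ## API: push-forward, separated coefficients, words -/

/-- The empty word pushes to the origin. [folklore] -/
theorem push_zero {s : ℕ} (E : Fin s → Fin 2 → ℤ) : push E 0 = 0 := by simp [push]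

/-- A pure power word pushes to a ray point. [folklore] -/
theorem push_single {s : ℕ} (E : Fin s → Fin 2 → ℤ) (e : Fin s) (k : ℕ) :
    push E (Pi.single e k) = (k : ℤ) • E e := by
  classical
  unfold push
  rw [Finset.sum_eq_single e]
  · simp
  · intro b _ hb; simp [hb]
  · intro h; exact absurd (Finset.mem_univ e) h

/-- The push-forward is additive. [folklore] -/
theorem push_add {s : ℕ} (E : Fin s → Fin 2 → ℤ) (n n' : Fin s → ℕ) : push E (n + n') = push E n + push E n' := by
  simp only [push, Pi.add_apply, Nat.cast_add, add_smul, Finset.sum_add_distrib]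

/-- Separated coefficient of a pure power word. [folklore] -/
theorem sepCoeff_single {s : ℕ} (U : Fin s → ℂ[X]) (hU0 : ∀ e, (U e).coeff 0 = 1) (e : Fin s) (k : ℕ) :
    sepCoeff U (Pi.single e k) = (U e).coeff k := by
  classical
  unfold sepCoeff
  rw [Finset.prod_eq_single e]
  · simp
  · intro b _ hb; simp [hb, hU0]
  · intro h; exact absurd (Finset.mem_univ e) h

/-- Separated coefficient of a two-letter word. [folklore] -/
theorem sepCoeff_pair {s : ℕ} (U : Fin s → ℂ[X]) (hU0 : ∀ e, (U e).coeff 0 = 1) {e₁ e₂ : Fin s}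
    (hne : e₁ ≠ e₂) (k₁ k₂ : ℕ) :
    sepCoeff U (Pi.single e₁ k₁ + Pi.single e₂ k₂) = (U e₁).coeff k₁ * (U e₂).coeff k₂ := by
  classical
  unfold sepCoeff
  rw [← Finset.prod_erase_mul _ _ (Finset.mem_univ e₁),
    ← Finset.prod_erase_mul _ _ (Finset.mem_erase.mpr ⟨hne.symm, Finset.mem_univ e₂⟩)]
  have h1 : (Pi.single e₁ k₁ + Pi.single e₂ k₂ : Fin s → ℕ) e₁ = k₁ := by
    simp [hne]
  have h2 : (Pi.single e₁ k₁ + Pi.single e₂ k₂ : Fin s → ℕ) e₂ = k₂ := by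
    simp [hne.symm]
  have hrest : ∏ x ∈ (Finset.univ.erase e₁).erase e₂, (U x).coeff ((Pi.single e₁ k₁ + Pi.single e₂ k₂ : Fin s → ℕ) x) = 1 := by
    refine Finset.prod_eq_one fun x hx => ?_
    simp only [Finset.mem_erase] at hx
    simp [hx.1, hx.2.1, hU0]
  rw [hrest, h1, h2]; ring

/-- A nonzero separated coefficient has all its univariate factors nonzero. [folklore] -/
theorem sepCoeff_ne_zero_apply {s : ℕ} {U : Fin s → ℂ[X]} {n : Fin s → ℕ} (h : sepCoeff U n ≠ 0) (e : Fin s) :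
    (U e).coeff (n e) ≠ 0 := by
  unfold sepCoeff at h
  exact fun h0 => h (Finset.prod_eq_zero (Finset.mem_univ e) h0)

/-- A word with at most one nonzero letter is `0` or a pure power. [folklore] -/
theorem eq_zero_or_single_of_card_le_one {s : ℕ} (n : Fin s → ℕ)
    (h : (Finset.univ.filter fun e => n e ≠ 0).card ≤ 1) :
    n = 0 ∨ ∃ e k, 1 ≤ k ∧ n = Pi.single e k := by
  classical
  by_cases h0 : n = 0
  · exact Or.inl h0
  right
  obtain ⟨e, he⟩ : ∃ e, n e ≠ 0 := by
    by_contra hall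
    push Not at hall
    exact h0 (funext hall)
  refine ⟨e, n e, Nat.one_le_iff_ne_zero.mpr he, ?_⟩
  funext x
  by_cases hx : x = e
  · subst hx; simp
  · have : n x = 0 := by
      by_contra hnx
      have h2 : 2 ≤ (Finset.univ.filter fun e => n e ≠ 0).card := by
        have hsub : ({e, x} : Finset (Fin s)) ⊆ Finset.univ.filter fun e => n e ≠ 0 := by
          intro y hy
          simp only [Finset.mem_insert, Finset.mem_singleton] at hy
          rcases hy with rfl | rfl <;> simp [he, hnx]
        have := Finset.card_le_card hsub
        rwa [Finset.card_pair (Ne.symm hx)] at this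
      omega
    simp [hx, this]

/-- A word pushing to a nonzero off-ray point has at least two nonzero letters. [folklore] -/
theorem two_le_card_of_offRay {s : ℕ} (E : Fin s → Fin 2 → ℤ) {n : Fin s → ℕ} {v : Fin 2 → ℤ}
    (hpush : push E n = v) (hv0 : v ≠ 0) (hoff : ¬ OnRay E v) :
    2 ≤ (Finset.univ.filter fun e => n e ≠ 0).card := by
  by_contra hlt
  rcases eq_zero_or_single_of_card_le_one n (by omega) with h | ⟨e, k, hk, h⟩
  · subst h; rw [push_zero] at hpush; exact hv0 hpush.symm
  · subst h; rw [push_single] at hpush; exact hoff ⟨e, k, hk, hpush.symm⟩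

/-! ## Orders of univariate factors -/

/-- The order is the least positive exponent with a nonzero coefficient. [folklore] -/
theorem IsOrder.le_of_coeff_ne_zero {P : ℂ[X]} {k j : ℕ} (h : IsOrder P k) (hj : 1 ≤ j) (hPj : P.coeff j ≠ 0) :
    k ≤ j := by
  by_contra hlt
  exact hPj (h.2.2 j hj (by omega))

/-- The order is unique. [folklore] -/
theorem IsOrder.unique {P : ℂ[X]} {k k' : ℕ} (h : IsOrder P k) (h' : IsOrder P k') : k = k' :=
  le_antisymm (h.le_of_coeff_ne_zero h'.1 h'.2.1) (h'.le_of_coeff_ne_zero h.1 h.2.1)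

/-- The order is at most the degree. [folklore] -/
theorem IsOrder.le_natDegree {P : ℂ[X]} {k : ℕ} (h : IsOrder P k) : k ≤ P.natDegree :=
  Polynomial.le_natDegree_of_ne_zero h.2.1

/-- An active factor has an order. [folklore] -/
theorem exists_isOrder {P : ℂ[X]} (h : ∃ k, 1 ≤ k ∧ P.coeff k ≠ 0) : ∃ k, IsOrder P k := by
  classical
  refine ⟨Nat.find h, (Nat.find_spec h).1, (Nat.find_spec h).2, fun j hj hjlt => ?_⟩
  by_contra hne
  exact Nat.find_min h hjlt ⟨hj, hne⟩

/-! ## Membership in the box -/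

/-- Pure power words of exponent `≤ D` lie in the box. [folklore] -/
theorem single_mem_box {s D : ℕ} (e : Fin s) {k : ℕ} (hk : k ≤ D) : (Pi.single e k : Fin s → ℕ) ∈ box s D := by
  classical
  simp only [box, Fintype.mem_piFinset, Finset.mem_range]
  intro x
  by_cases hx : x = e
  · subst hx; simp; omega
  · simp [hx]

/-- Two-letter words of exponents `≤ D` lie in the box. [folklore] -/
theorem pair_mem_box {s D : ℕ} {e₁ e₂ : Fin s} (hne : e₁ ≠ e₂) {k₁ k₂ : ℕ} (h1 : k₁ ≤ D) (h2 : k₂ ≤ D) :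
    (Pi.single e₁ k₁ + Pi.single e₂ k₂ : Fin s → ℕ) ∈ box s D := by
  classical
  simp only [box, Fintype.mem_piFinset, Finset.mem_range, Pi.add_apply]
  intro x
  by_cases hx1 : x = e₁
  · subst hx1; simp [hne]; omega
  · by_cases hx2 : x = e₂
    · subst hx2; simp [hne.symm]; omega
    · simp [hx1, hx2]

/-! ## The weight bound: words with two letters weigh at least the two lightest orders -/


/-- A nonzero positive-order coefficient makes the factor active. [folklore] -/
theorem active_of_coeff_ne_zero {P : ℂ[X]} {k : ℕ} (hk : 1 ≤ k) (h : P.coeff k ≠ 0) : Active P := ⟨k, hk, h⟩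

/-- **Weight bound.** Let `o` give the orders of the active factors of a separated product `P`, let `e₁`
minimise `o_e ⟨w, E_e⟩` over the active directions and `e₂` minimise it over the active directions `≠ e₁`.
Then every word with at least two nonzero letters and nonzero separated coefficient weighs at least
`o_{e₁}⟨w,E_{e₁}⟩ + o_{e₂}⟨w,E_{e₂}⟩`, with equality only for the two-letter word `o_{e₁}[e₁] + o_{e₂}[e₂]`.
[folklore] -/
theorem weight_ge_two_lightest {s : ℕ} (E : Fin s → Fin 2 → ℤ) (w : Fin 2 → ℝ)
    (hw : ∀ e, 0 < wt w (E e)) (hgen : Function.Injective (wt w))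
    (hE : ∀ e e' : Fin s, ∀ k k' : ℕ, 1 ≤ k → (k : ℤ) • E e = (k' : ℤ) • E e' → e = e')
    (P : Fin s → ℂ[X]) (o : Fin s → ℕ) (ho : ∀ e, Active (P e) → IsOrder (P e) (o e))
    (e₁ e₂ : Fin s) (hne : e₁ ≠ e₂) (h2 : Active (P e₂))
    (h1min : ∀ e, Active (P e) → (o e₁ : ℝ) * wt w (E e₁) ≤ (o e : ℝ) * wt w (E e))
    (h2min : ∀ e, e ≠ e₁ → Active (P e) → (o e₂ : ℝ) * wt w (E e₂) ≤ (o e : ℝ) * wt w (E e))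
    (n : Fin s → ℕ) (hn2 : 2 ≤ (Finset.univ.filter fun e => n e ≠ 0).card) (hP : sepCoeff P n ≠ 0) :
    (o e₁ : ℝ) * wt w (E e₁) + (o e₂ : ℝ) * wt w (E e₂) ≤ wt w (push E n) ∧
      ((o e₁ : ℝ) * wt w (E e₁) + (o e₂ : ℝ) * wt w (E e₂) = wt w (push E n) →
        n = Pi.single e₁ (o e₁) + Pi.single e₂ (o e₂)) := by
  classical
  set S := Finset.univ.filter fun e => n e ≠ 0 with hS
  set t : Fin s → ℝ := fun e => (n e : ℝ) * wt w (E e) with ht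
  set val : Fin s → ℝ := fun e => (o e : ℝ) * wt w (E e) with hval
  -- letters of `S` are active, with order at most the letter
  have hact : ∀ e ∈ S, Active (P e) ∧ o e ≤ n e := by
    intro e he
    have hne0 : n e ≠ 0 := (Finset.mem_filter.mp he).2
    have h1 : 1 ≤ n e := Nat.one_le_iff_ne_zero.mpr hne0
    have hc : (P e).coeff (n e) ≠ 0 := sepCoeff_ne_zero_apply hP e
    have hA : Active (P e) := active_of_coeff_ne_zero h1 hc
    exact ⟨hA, (ho e hA).le_of_coeff_ne_zero h1 hc⟩
  have htval : ∀ e ∈ S, val e ≤ t e := by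
    intro e he
    have := (hact e he).2
    simp only [hval, ht]
    exact mul_le_mul_of_nonneg_right (by exact_mod_cast this) (hw e).le
  have htpos : ∀ e ∈ S, 0 < t e := by
    intro e he
    have hne0 : n e ≠ 0 := (Finset.mem_filter.mp he).2
    have : (0 : ℝ) < n e := by exact_mod_cast Nat.pos_of_ne_zero hne0
    exact mul_pos this (hw e)
  have hvalpos : ∀ e, Active (P e) → 0 < val e := by
    intro e hA
    have : (0 : ℝ) < o e := by exact_mod_cast (ho e hA).1
    exact mul_pos this (hw e)
  -- the weight of the word is the sum of `t` over `S`
  have hT : wt w (push E n) = ∑ e ∈ S, t e := by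
    rw [wt_push, hS, Finset.sum_filter_of_ne]
    intro e _ hte h0
    apply hte
    simp [ht, h0]
  -- identification of a direction from an equality of weighted orders
  have hident : ∀ a b : Fin s, Active (P a) → val a = val b → a = b := by
    intro a b hA hab
    have h' : wt w ((o a : ℤ) • E a) = wt w ((o b : ℤ) • E b) := by
      rw [wt_zsmul, wt_zsmul]; push_cast; exact hab
    exact hE a b (o a) (o b) (ho a hA).1 (hgen h')
  by_cases he1 : e₁ ∈ S
  · -- pick a second letter `b ≠ e₁`
    have hcard : 0 < (S.erase e₁).card := by rw [Finset.card_erase_of_mem he1]; omega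
    obtain ⟨b, hb⟩ := Finset.card_pos.mp hcard
    have hbS : b ∈ S := Finset.mem_of_mem_erase hb
    have hbne : b ≠ e₁ := Finset.ne_of_mem_erase hb
    have hsub : ({e₁, b} : Finset (Fin s)) ⊆ S := by
      intro x hx
      simp only [Finset.mem_insert, Finset.mem_singleton] at hx
      rcases hx with rfl | rfl
      · exact he1
      · exact hbS
    have hsplit : ∑ e ∈ S, t e = (t e₁ + t b) + ∑ e ∈ S \ {e₁, b}, t e := by
      rw [← Finset.sum_sdiff hsub, Finset.sum_pair (Ne.symm hbne)]; ring
    have hR : 0 ≤ ∑ e ∈ S \ {e₁, b}, t e :=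
      Finset.sum_nonneg fun e he => (htpos e (Finset.mem_sdiff.mp he).1).le
    have i1 := htval e₁ he1
    have i2 := htval b hbS
    have i3 : val e₂ ≤ val b := h2min b hbne (hact b hbS).1
    refine ⟨by rw [hT, hsplit]; simp only [hval] at i1 i2 i3 ⊢; linarith, fun heq => ?_⟩
    rw [hT, hsplit] at heq
    simp only [hval, ht] at i1 i2 i3 heq
    have hR0 : ∑ e ∈ S \ {e₁, b}, (n e : ℝ) * wt w (E e) = 0 := by linarith
    have ht1 : (n e₁ : ℝ) * wt w (E e₁) = (o e₁ : ℝ) * wt w (E e₁) := by linarith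
    have htb : (n b : ℝ) * wt w (E b) = (o b : ℝ) * wt w (E b) := by linarith
    have hvb : (o b : ℝ) * wt w (E b) = (o e₂ : ℝ) * wt w (E e₂) := by linarith
    -- the rest of `S` is empty
    have hrest : S \ {e₁, b} = ∅ := by
      by_contra hne'
      obtain ⟨x, hx⟩ := Finset.nonempty_iff_ne_empty.mpr hne'
      have hxS := (Finset.mem_sdiff.mp hx).1
      have hlt : 0 < ∑ e ∈ S \ {e₁, b}, (n e : ℝ) * wt w (E e) :=
        Finset.sum_pos' (fun e he => (htpos e (Finset.mem_sdiff.mp he).1).le) ⟨x, hx, htpos x hxS⟩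
      linarith
    have hb2 : b = e₂ := hident b e₂ (hact b hbS).1 hvb
    subst hb2
    have hn1 : n e₁ = o e₁ := by
      have := mul_right_cancel₀ (hw e₁).ne' ht1
      exact_mod_cast this
    have hnb : n b = o b := by
      have := mul_right_cancel₀ (hw b).ne' htb
      exact_mod_cast this
    have hSsub : S ⊆ {e₁, b} := by
      intro x hx
      by_contra hxn
      have : x ∈ S \ {e₁, b} := Finset.mem_sdiff.mpr ⟨hx, hxn⟩
      rw [hrest] at this
      exact absurd this (Finset.notMem_empty x)
    funext x
    simp only [Pi.add_apply]
    by_cases hx1 : x = e₁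
    · subst hx1; simp [hbne.symm, hn1]
    · by_cases hx2 : x = b
      · subst hx2; simp [hbne, hnb]
      · have hxS : x ∉ S := fun hx => by
          have := hSsub hx
          simp only [Finset.mem_insert, Finset.mem_singleton] at this
          rcases this with h | h
          · exact hx1 h
          · exact hx2 h
        have : n x = 0 := by
          by_contra h
          exact hxS (Finset.mem_filter.mpr ⟨Finset.mem_univ x, h⟩)
        simp [hx1, hx2, this]
  · -- `e₁ ∉ S`: two letters `a ≠ b` of `S`, both `≠ e₁`; equality is impossible
    obtain ⟨a, ha, b, hb, hab⟩ := Finset.one_lt_card.mp (by omega : 1 < S.card)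
    have hane : a ≠ e₁ := fun h => he1 (h ▸ ha)
    have hbne : b ≠ e₁ := fun h => he1 (h ▸ hb)
    have hsub : ({a, b} : Finset (Fin s)) ⊆ S := by
      intro x hx
      simp only [Finset.mem_insert, Finset.mem_singleton] at hx
      rcases hx with rfl | rfl
      · exact ha
      · exact hb
    have hle : t a + t b ≤ ∑ e ∈ S, t e := by
      rw [← Finset.sum_pair hab]
      exact Finset.sum_le_sum_of_subset_of_nonneg hsub fun e he _ => (htpos e he).le
    have ia := htval a ha
    have ib := htval b hb
    have ja : val e₂ ≤ val a := h2min a hane (hact a ha).1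
    have jb : val e₂ ≤ val b := h2min b hbne (hact b hb).1
    have j12 : val e₁ ≤ val e₂ := h1min e₂ h2
    refine ⟨by rw [hT]; simp only [hval, ht] at ia ib ja jb j12 hle ⊢; linarith, fun heq => ?_⟩
    exfalso
    rw [hT] at heq
    simp only [hval, ht] at ia ib ja jb j12 hle heq
    have hv : (o e₂ : ℝ) * wt w (E e₂) = (o e₁ : ℝ) * wt w (E e₁) := by linarith
    exact hne (hident e₂ e₁ h2 hv).symm

end Summit.ValiantsHypothesis.ValiantsHypothesis.Theorems.NewtonTauWeakCorner

end
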